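import Literature.InformationTheory.QuantumCodes.QuantumMacWilliams
import HarnessLib

/-!
# Unitary-enumerator duality and the quantum Singleton bound for general codes — proofs

Topic `Literature/InformationTheory/QuantumCodes` (venture QEC, cell `qec`, PARTITION v2 row 06 / D2.6, rung X1).
THEOREMS ONLY: this file PROVES the named fact `Rains1999_quantumSingleton` of `WeightEnumeratorBounds.lean`
(E. M. Rains, *Nonbinary quantum codes*, IEEE Trans. Inform. Theory 45 (1999) 1827–1832 = arXiv:quant-ph/9703048
[Rains1999Nonbinary], Thm. 2 with `α = 2`: «Let `𝒞` be a `((n,K,d))_α` with `K > 1`. Then `K ≤ α^{n−2d+2}`»;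
for `α = 2` this is Knill–Laflamme's bound [KnillLaflamme1997, Thm. 5.1]), for ALL (pure or impure, additive or
not) qubit codes carried by their projection. The tree's `QuantumSingletonBound.lean` (qec-lit-4) proves the
ADDITIVE case by the cleaning dimension count; this file follows Rains's enumerator proof, made elementary over
`QuantumMacWilliams.lean` (Pauli expansion, conjugation signs, Knill–Laflamme termwise identity):

* §1 the **twirl over all Pauli words supported on a set `W`**: `Σ_{supp S ⊆ W} (−1)^{⟨S,T⟩} = 4^{|W|}·[T|_W = I]`
  (per site `Σ_Q sign(Q,P) = 4[P = I]`), hence `Σ_{supp S ⊆ W} S M S = 2^{−n} 4^{|W|} Σ_{supp T ⊆ Wᶜ} Tr(TM) T`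
  (= «`E_U(U A U†) = Tr(A)/dim U`» for the Pauli group on `W`), and the **duality of Rains's unitary enumerators**
  `B'_W(M₁,M₂) = A'_{Wᶜ}(M₁,M₂)` [Rains1998Enumerators, §2 Thm. 3 («`A'_S(M₁,M₂) = B'_{Sᶜ}(M₁,M₂)`») with Thm. 4
  (`A'_S = 2^{−|S|} Σ_{T ⊆ S} A_T`, `B'_S = 2^{−|S|} Σ_{T ⊆ S} B_T`)] in the support-sum form
  `Σ_{supp E ⊆ W} Tr(E M₁ E M₂) = 2^{−n} 4^{|W|} Σ_{supp E ⊆ Wᶜ} Tr(E M₁) Tr(E M₂)` (`slBOn_eq_slAOn_compl`).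
  For Hermitian `P` the support-indexed `A`-sum IS the tree's Kempe–Regev–Unger–de Wolf Fourier weight
  `QuantumComplexity.pauliWeight P W = Σ_{supp E ⊆ W} |Tr(EP)|²` (`slAOn_self_of_isHermitian`) — here this Fourier
  weight is the right notion (it is NOT a Hamming weight; cf. the ref-2 trap note in PARTITION D2.2).
* §2 **Knill–Laflamme on a support** (`|W| ≤ d − 1 ⇒ Σ_{supp ⊆ W} |Tr(EP)|² = K·Re Σ_{supp ⊆ W} Tr(EPEP)`), the
  **cleaning identity** `pauliWeight P W = K · 2^{−n} 4^{|W|} · pauliWeight P Wᶜ` for `|W| ≤ d − 1`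
  («`A'_{n−d+1} = K A'_{d−1}`»), and the **quantum Singleton bound**: counting form
  `K · 2^{min(2(d−1), n)} ≤ 2^n` on any finite register (two disjoint blocks of sizes `min(d−1, ·)`, monotonicity
  `pauliWeight_mono` and `pauliWeight P ∅ = K²`), then `Rains1999_quantumSingleton_holds`
  («If `2d ≥ n+2`, then … a contradiction for `K > 1`»; otherwise `K ≤ 2^{n−2d+2}`).

Definitions introduced (proof vocabulary, column: definition): `slAOn`, `slBOn` (support-indexed Shor–Laflamme
sums = `2^{|W|} A'_W`, `2^{|W|} B'_W`). All theorems: column proved; no named facts, no `sorry`.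

## Mathlib / tree search

Tree: `QuantumMacWilliams.lean` (this seat: `letterSign`, `wordSign`, `pauliString_conj`,
`eq_inv_smul_sum_pauliCoeff_smul`, `pauliCoeff_sq_eq_of_detects`, `pauliCoeff_mul_self_of_isHermitian`);
`QuantumComplexity.stringsOn` (= `Fintype.piFinset`), `mem_stringsOn`, `pauliWeight`, `pauliWeight_mono`,
`pauliWeight_empty` (PauliExpansion/PauliParseval); `IsCodeProjection`, `DetectsWeightLE`, `pauliWt`,
`Rains1999_quantumSingleton` (WeightEnumeratorBounds, qec-type-06); the additive case `quantumSingleton_additive`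
(QuantumSingletonBound.lean, qec-lit-4) is a different theorem about `SympVec` codes and is not restated.
Mathlib: `Finset.prod_univ_sum`, `Finset.exists_subset_card_eq`, `le_of_pow_le_pow_left₀`, `zpow_le_zpow_right₀`.
-/

noncomputable section

open Finset Matrix
open Literature.Computability.QuantumComplexity

namespace Literature.InformationTheory.QuantumCodes

variable {ι : Type*} [Fintype ι] [DecidableEq ι]

/-! ### §1. Twirl over all words supported on a set; the duality `B'_W = A'_{Wᶜ}` -/

/-- The uniform twirl over one letter kills every non-identity letter: `Σ_Q sign(Q,P) = 4 [P = I]` (integer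
form of `Pauli.sum_sign`). [cite: Rains1998Enumerators, §2 Thm. 3 (E_U(U A U†) = Tr(A)/dim U)] -/
theorem sum_letterSign (P : Pauli) : ∑ Q, letterSign Q P = if P = Pauli.I then 4 else 0 := by
  rw [Pauli.sum_univ]
  cases P <;> simp [letterSign]

/-- **Twirl over all words supported on `W`, sign form**: `Σ_{supp S ⊆ W} (−1)^{⟨S,T⟩} = 4^{|W|}` if `T` is
the identity on `W`, and `0` otherwise. [cite: Rains1998Enumerators, §2 Thm. 4 (proof: A'_S(E₁,E₂) = 0
unless supp ⊆ S and E₁ = E₂)] -/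
theorem sum_stringsOn_wordSign (W : Finset ι) (T : ι → Pauli) :
    ∑ S ∈ stringsOn W, wordSign S T = if ∀ i ∈ W, T i = Pauli.I then 4 ^ #W else 0 := by
  classical
  have h1 : ∑ S ∈ stringsOn W, wordSign S T =
      ∏ i, ∑ Q ∈ (if i ∈ W then Finset.univ else {Pauli.I}), letterSign Q (T i) := by
    rw [stringsOn, Finset.prod_univ_sum]
    rfl
  have h2 : ∀ i, ∑ Q ∈ (if i ∈ W then Finset.univ else {Pauli.I}), letterSign Q (T i) =
      if i ∈ W then (if T i = Pauli.I then 4 else 0) else 1 := by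
    intro i
    split_ifs with hi hT
    · rw [sum_letterSign, if_pos hT]
    · rw [sum_letterSign, if_neg hT]
    · simp [letterSign]
  rw [h1]
  simp only [h2]
  rw [Finset.prod_ite, Finset.prod_const_one, mul_one, Finset.filter_univ_mem]
  by_cases h : ∀ i ∈ W, T i = Pauli.I
  · rw [if_pos h, Finset.prod_congr rfl fun i hi => if_pos (h i hi), Finset.prod_const]
  · rw [if_neg h]
    push Not at h
    obtain ⟨i, hi, hne⟩ := h
    exact Finset.prod_eq_zero hi (if_neg hne)

/-- **Twirl of a Pauli word over all words supported on `W`**: `Σ_{supp S ⊆ W} S T S = 4^{|W|} T` if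
`supp T ∩ W = ∅`, else `0`. [cite: Rains1998Enumerators, §2 Thm. 3 and §2 Thm. 4] -/
theorem sum_stringsOn_conj_pauliString (W : Finset ι) (T : ι → Pauli) :
    ∑ S ∈ stringsOn W, pauliString S * pauliString T * pauliString S =
      (if ∀ i ∈ W, T i = Pauli.I then (4 : ℂ) ^ #W else 0) • pauliString T := by
  classical
  simp only [pauliString_conj, ← Finset.sum_smul]
  congr 1
  rw [← Int.cast_sum, sum_stringsOn_wordSign]
  split_ifs <;> simp

/-- The words that are the identity on `W` are exactly the words supported on `Wᶜ`. [cite: Rains1998Enumerators, §1 (supp(E))] -/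
theorem filter_forall_eq_I_eq_stringsOn_compl (W : Finset ι) :
    (Finset.univ.filter fun T : ι → Pauli => ∀ i ∈ W, T i = Pauli.I) = stringsOn Wᶜ := by
  ext T
  simp only [Finset.mem_filter, Finset.mem_univ, true_and, mem_stringsOn, Finset.mem_compl, not_not]

/-- **Twirl of an operator over all words supported on `W`** through the Pauli expansion:
`Σ_{supp S ⊆ W} S M S = 2^{−n} 4^{|W|} Σ_{supp T ⊆ Wᶜ} Tr(T M) T` — i.e. `4^{−|W|} Σ_{S} S M S = Tr_W(M) ⊗ 2^{−|W|}𝟙_W`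
(«`E_U(U A U†) = Tr(A)/dim(U)`»). [cite: Rains1998Enumerators, §2 Thm. 3 (B'_S = Tr_{Sᶜ}(Tr_S M₁ Tr_S M₂))] -/
theorem sum_stringsOn_conj (W : Finset ι) (M : Matrix (ι → Bool) (ι → Bool) ℂ) :
    ∑ S ∈ stringsOn W, pauliString S * M * pauliString S =
      (((2 : ℂ) ^ Fintype.card ι)⁻¹ * 4 ^ #W) • ∑ T ∈ stringsOn Wᶜ, pauliCoeff M T • pauliString T := by
  classical
  conv_lhs => rw [eq_inv_smul_sum_pauliCoeff_smul M]
  simp only [Matrix.mul_smul, Matrix.smul_mul, Finset.mul_sum, Finset.sum_mul, ← Finset.smul_sum]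
  rw [mul_smul]
  congr 1
  rw [Finset.sum_comm]
  have h : ∀ T : ι → Pauli,
      ∑ S ∈ stringsOn W, pauliCoeff M T • (pauliString S * pauliString T * pauliString S) =
        if ∀ i ∈ W, T i = Pauli.I then ((4 : ℂ) ^ #W) • (pauliCoeff M T • pauliString T) else 0 := by
    intro T
    rw [← Finset.smul_sum, sum_stringsOn_conj_pauliString, smul_comm]
    split_ifs
    · rfl
    · rw [zero_smul]
  rw [Finset.sum_congr rfl fun T _ => h T, ← Finset.sum_filter, filter_forall_eq_I_eq_stringsOn_compl,
    Finset.smul_sum]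

/-- The support-indexed `A`-sum `Σ_{supp E ⊆ W} Tr(E M₁) Tr(E M₂) = Σ_{T ⊆ W} A_T(M₁,M₂) = 2^{|W|} A'_W(M₁,M₂)`.
[cite: Rains1998Enumerators, §1 (A_S) and §2 Thm. 4 (A'_S = 2^{−|S|} Σ_{T ⊆ S} A_T)] -/
def slAOn (M₁ M₂ : Matrix (ι → Bool) (ι → Bool) ℂ) (W : Finset ι) : ℂ :=
  ∑ E ∈ stringsOn W, pauliCoeff M₁ E * pauliCoeff M₂ E

/-- The support-indexed `B`-sum `Σ_{supp E ⊆ W} Tr(E M₁ E M₂) = Σ_{T ⊆ W} B_T(M₁,M₂) = 2^{|W|} B'_W(M₁,M₂)`.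
[cite: Rains1998Enumerators, §1 (B_S) and §2 Thm. 4 (B'_S = 2^{−|S|} Σ_{T ⊆ S} B_T)] -/
def slBOn (M₁ M₂ : Matrix (ι → Bool) (ι → Bool) ℂ) (W : Finset ι) : ℂ :=
  ∑ E ∈ stringsOn W, (pauliString E * M₁ * pauliString E * M₂).trace

/-- **Duality of the unitary enumerators, `B'_W = A'_{Wᶜ}`** (Rains 1998 Thm. 3 with Thm. 4), in the
support-sum form `Σ_{supp E ⊆ W} Tr(E M₁ E M₂) = 2^{−n} 4^{|W|} Σ_{supp E ⊆ Wᶜ} Tr(E M₁) Tr(E M₂)`.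
[cite: Rains1998Enumerators, §2 Thm. 3 («A'_S(M₁,M₂) = B'_{Sᶜ}(M₁,M₂)») and §2 Thm. 4] -/
theorem slBOn_eq_slAOn_compl (W : Finset ι) (M₁ M₂ : Matrix (ι → Bool) (ι → Bool) ℂ) :
    slBOn M₁ M₂ W = ((2 : ℂ) ^ Fintype.card ι)⁻¹ * 4 ^ #W * slAOn M₁ M₂ Wᶜ := by
  classical
  have h1 : slBOn M₁ M₂ W = ((∑ E ∈ stringsOn W, pauliString E * M₁ * pauliString E) * M₂).trace := by
    rw [slBOn, Finset.sum_mul, Matrix.trace_sum]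
  rw [h1, sum_stringsOn_conj, Matrix.smul_mul, Matrix.trace_smul, Finset.sum_mul, Matrix.trace_sum, smul_eq_mul]
  unfold slAOn
  simp only [Finset.mul_sum]
  refine Finset.sum_congr rfl fun T _ => ?_
  rw [Matrix.smul_mul, Matrix.trace_smul, smul_eq_mul, ← pauliCoeff_eq]

/-- For Hermitian `P`, the support-indexed `A`-sum `Σ_{supp E ⊆ W} Tr(EP)²` is the tree's (Kempe–Regev–Unger–
de Wolf) Fourier weight `pauliWeight P W = Σ_{supp E ⊆ W} |Tr(EP)|²` — i.e. `2^{|W|} A'_W(P,P)`.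
[cite: Rains1998Enumerators, §1 Thm. 2 («A_d(M,M†) = Σ |Tr(EM)|²») and §2 Thm. 4] -/
theorem slAOn_self_of_isHermitian {P : Matrix (ι → Bool) (ι → Bool) ℂ} (hP : P.IsHermitian) (W : Finset ι) :
    slAOn P P W = (pauliWeight P W : ℂ) := by
  rw [slAOn, pauliWeight_eq, Complex.ofReal_sum]
  exact Finset.sum_congr rfl fun T _ => pauliCoeff_mul_self_of_isHermitian hP T

/-! ### §2. Knill–Laflamme on a support, the cleaning identity, and the quantum Singleton bound -/

/-- A word supported on `W` has weight at most `|W|`. [cite: Rains1998Enumerators, §1 («wt(E) = |supp(E)|»)] -/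
theorem pauliWt_le_card_of_mem_stringsOn {W : Finset ι} {E : ι → Pauli} (hE : E ∈ stringsOn W) :
    pauliWt E ≤ #W := by
  unfold pauliWt
  refine Finset.card_le_card fun i hi => ?_
  rw [Finset.mem_filter] at hi
  by_contra hW
  exact hi.2 (mem_stringsOn.1 hE i hW)

/-- **Knill–Laflamme on a support** (the minimum-distance criterion `K B'_S = A'_S` for `|S| ≤ d − 1`): if `P`
is a Hermitian idempotent of trace `K` detecting every error of weight `≤ t` and `|W| ≤ t`, then
`Σ_{supp E ⊆ W} |Tr(EP)|² = K · Re Σ_{supp E ⊆ W} Tr(EPEP)`.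
[cite: Rains1998Enumerators, §1 Thm. 2 and §2 (minimum distance criteria); Rains1999Nonbinary, proof of Thm. 2 p. 1828 («B_i = K^{−1} A_i for 0 ≤ i ≤ d−1»)] -/
theorem pauliWeight_eq_mul_re_slBOn {P : Matrix (ι → Bool) (ι → Bool) ℂ} (hH : P.IsHermitian)
    (hPP : P * P = P) {K : ℕ} (htr : P.trace = (K : ℂ)) {t : ℕ} (hdet : DetectsWeightLE P t) {W : Finset ι}
    (hW : #W ≤ t) : pauliWeight P W = K * (slBOn P P W).re := by
  rw [pauliWeight_eq, slBOn, Complex.re_sum, Finset.mul_sum]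
  refine Finset.sum_congr rfl fun E hE => ?_
  obtain ⟨c, hc⟩ := hdet E ((pauliWt_le_card_of_mem_stringsOn hE).trans hW)
  have h := pauliCoeff_sq_eq_of_detects hPP htr hc
  rw [pauliCoeff_mul_self_of_isHermitian hH] at h
  have h' := congrArg Complex.re h
  rw [Complex.ofReal_re, Complex.mul_re, Complex.natCast_re, Complex.natCast_im, zero_mul, sub_zero] at h'
  exact h'

/-- **The cleaning identity** `A'_S = K B'_S = K A'_{Sᶜ}` for `|S| ≤ d − 1`, in Fourier-weight form:
`pauliWeight P W = K · 2^{−n} 4^{|W|} · pauliWeight P Wᶜ`.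
[cite: Rains1999Nonbinary, proof of Thm. 2 p. 1828 («A'_{n−d+1} = K A'_{d−1}»); Rains1998Enumerators, §2 Thm. 3] -/
theorem pauliWeight_eq_mul_pauliWeight_compl {P : Matrix (ι → Bool) (ι → Bool) ℂ} (hH : P.IsHermitian)
    (hPP : P * P = P) {K : ℕ} (htr : P.trace = (K : ℂ)) {t : ℕ} (hdet : DetectsWeightLE P t) {W : Finset ι}
    (hW : #W ≤ t) :
    pauliWeight P W = K * ((2 ^ Fintype.card ι)⁻¹ * 4 ^ #W * pauliWeight P Wᶜ) := by
  rw [pauliWeight_eq_mul_re_slBOn hH hPP htr hdet hW, slBOn_eq_slAOn_compl, slAOn_self_of_isHermitian hH]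
  congr 1
  have h : ((2 : ℂ) ^ Fintype.card ι)⁻¹ * 4 ^ #W * (pauliWeight P Wᶜ : ℂ) =
      (((2 ^ Fintype.card ι)⁻¹ * 4 ^ #W * pauliWeight P Wᶜ : ℝ) : ℂ) := by push_cast; ring
  rw [h, Complex.ofReal_re]

omit [Fintype ι] [DecidableEq ι] in
/-- Block sizes: `min(d−1,n) + min(d−1, n − min(d−1,n)) = min(2(d−1), n)` (plumbing). [folklore] -/
private theorem min_add_min_eq (d n : ℕ) :
    min (d - 1) n + min (d - 1) (n - min (d - 1) n) = min (2 * (d - 1)) n := by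
  omega

/-- **Quantum Singleton bound, counting form, on an arbitrary finite register**: if `P` is the projection onto an
`((n,K,d))` then `K · 2^{min(2(d−1), n)} ≤ 2^n`. (Two disjoint blocks `S`, `S'` of sizes `min(d−1,·)`; the cleaning
identity for each, monotonicity of the Fourier weight and `pauliWeight P ∅ = K²`.)
[cite: Rains1999Nonbinary, Thm. 2 p. 1828 (Quantum Singleton bound) and its proof] -/
theorem mul_pow_min_le_pow_of_isCodeProjection {K d : ℕ} {P : Matrix (ι → Bool) (ι → Bool) ℂ}
    (hP : IsCodeProjection P K d) : K * 2 ^ min (2 * (d - 1)) (Fintype.card ι) ≤ 2 ^ Fintype.card ι := by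
  classical
  obtain ⟨hH, hPP, htr, hdet⟩ := hP
  set n := Fintype.card ι with hn
  rcases Nat.eq_zero_or_pos K with hK0 | hKpos
  · rw [hK0, zero_mul]; exact Nat.zero_le _
  -- the two blocks
  obtain ⟨S, -, hS⟩ := Finset.exists_subset_card_eq (s := (Finset.univ : Finset ι)) (n := min (d - 1) n)
    (by rw [Finset.card_univ]; exact min_le_right _ _)
  obtain ⟨S', hS'sub, hS'⟩ := Finset.exists_subset_card_eq (s := Sᶜ) (n := min (d - 1) (n - min (d - 1) n))
    (by rw [Finset.card_compl, hS]; exact min_le_right _ _)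
  have hSsub : S ⊆ S'ᶜ := fun i hi => Finset.mem_compl.2 fun hi' => Finset.mem_compl.1 (hS'sub hi') hi
  -- cleaning identities and monotonicity
  have e1 := pauliWeight_eq_mul_pauliWeight_compl hH hPP htr hdet (W := S) (by rw [hS]; exact min_le_left _ _)
  have e2 := pauliWeight_eq_mul_pauliWeight_compl hH hPP htr hdet (W := S') (by rw [hS']; exact min_le_left _ _)
  have m1 : pauliWeight P S' ≤ pauliWeight P Sᶜ := pauliWeight_mono P hS'sub
  have m2 : pauliWeight P S ≤ pauliWeight P S'ᶜ := pauliWeight_mono P hSsub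
  have pos : 0 < pauliWeight P S := by
    refine lt_of_lt_of_le ?_ (pauliWeight_mono P (Finset.empty_subset S))
    rw [pauliWeight_empty, htr, Complex.norm_natCast]
    exact pow_pos (Nat.cast_pos.2 hKpos) 2
  rw [hS] at e1
  rw [hS'] at e2
  -- `α β x ≤ x` with `x > 0`
  set α : ℝ := K * ((2 ^ n)⁻¹ * 4 ^ min (d - 1) n) with hα
  set β : ℝ := K * ((2 ^ n)⁻¹ * 4 ^ min (d - 1) (n - min (d - 1) n)) with hβ
  have hαe : pauliWeight P S = α * pauliWeight P Sᶜ := by rw [e1, hα]; ring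
  have hβe : pauliWeight P S' = β * pauliWeight P S'ᶜ := by rw [e2, hβ]; ring
  have hα0 : 0 ≤ α := by positivity
  have hβ0 : 0 ≤ β := by positivity
  have key : α * β * pauliWeight P S ≤ pauliWeight P S := by
    calc α * β * pauliWeight P S ≤ α * β * pauliWeight P S'ᶜ := by gcongr
      _ = α * pauliWeight P S' := by rw [hβe]; ring
      _ ≤ α * pauliWeight P Sᶜ := by gcongr
      _ = pauliWeight P S := by rw [hαe]
  have hab : α * β ≤ 1 := by nlinarith
  -- unfold `α β`: `K² 4^{s+s'} ≤ 4^n`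
  have h4 : (K : ℝ) ^ 2 * 4 ^ (min (d - 1) n + min (d - 1) (n - min (d - 1) n)) ≤ 4 ^ n := by
    have h2n : (2 : ℝ) ^ n ≠ 0 := by positivity
    have h4n : (4 : ℝ) ^ n = 2 ^ n * 2 ^ n := by rw [← mul_pow]; norm_num
    have e : α * β * 4 ^ n = (K : ℝ) ^ 2 * 4 ^ (min (d - 1) n + min (d - 1) (n - min (d - 1) n)) := by
      calc α * β * 4 ^ n = (K : ℝ) ^ 2 * (4 ^ min (d - 1) n * 4 ^ min (d - 1) (n - min (d - 1) n)) *
            (((2 : ℝ) ^ n)⁻¹ * 2 ^ n) * (((2 : ℝ) ^ n)⁻¹ * 2 ^ n) := by rw [hα, hβ, h4n]; ring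
        _ = _ := by rw [inv_mul_cancel₀ h2n, pow_add]; ring
    rw [← e]
    calc α * β * 4 ^ n ≤ 1 * 4 ^ n := by gcongr
      _ = 4 ^ n := one_mul _
  rw [min_add_min_eq] at h4
  have h6 : ((K : ℝ) * 2 ^ min (2 * (d - 1)) n) ^ 2 ≤ ((2 : ℝ) ^ n) ^ 2 := by
    have e4 : ∀ m : ℕ, ((2 : ℝ) ^ m) ^ 2 = 4 ^ m := fun m => by
      rw [← pow_mul, mul_comm, pow_mul]; norm_num
    rw [mul_pow, e4, e4]
    exact h4
  have h5 : (K : ℝ) * 2 ^ min (2 * (d - 1)) n ≤ (2 : ℝ) ^ n :=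
    le_of_pow_le_pow_left₀ two_ne_zero (by positivity) h6
  exact_mod_cast h5

/-- **Quantum Singleton bound (Knill–Laflamme 1997 / Rains 1999), general qubit codes — discharge of the named
fact `Rains1999_quantumSingleton`.** «Let `𝒞` be a `((n,K,d))_α` with `K > 1`. Then `K ≤ α^{n−2d+2}`.» (`α = 2`;
pure or impure). If `2(d−1) ≤ n` this is the counting form divided by `2^{2(d−1)}`; otherwise the counting form
forces `K ≤ 1`, contradicting `K > 1` («If `2d ≥ n+2`, then we have both `A'_{n−d+1} = K A'_{d−1}` and
`A'_{d−1} = K A'_{n−d+1}`, a contradiction for `K > 1`»). Column: proved.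
[cite: Rains1999Nonbinary, Thm. 2 p. 1828 (Quantum Singleton bound); KnillLaflamme1997 Thm. 5.1] -/
theorem Rains1999_quantumSingleton_holds : Rains1999_quantumSingleton := by
  intro n K d P hK hP
  have h := mul_pow_min_le_pow_of_isCodeProjection hP
  rw [Fintype.card_fin] at h
  by_cases hdn : 2 * (d - 1) ≤ n
  · rw [min_eq_left hdn] at h
    -- `K ≤ 2^{n − 2(d−1)}` in `ℕ`
    have hK' : K ≤ 2 ^ (n - 2 * (d - 1)) := by
      have e : 2 ^ n = 2 ^ (2 * (d - 1)) * 2 ^ (n - 2 * (d - 1)) := by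
        rw [← pow_add, Nat.add_sub_cancel' hdn]
      rw [e, mul_comm] at h
      exact Nat.le_of_mul_le_mul_left h (by positivity)
    calc (K : ℝ) ≤ ((2 ^ (n - 2 * (d - 1)) : ℕ) : ℝ) := by exact_mod_cast hK'
      _ = (2 : ℝ) ^ ((n - 2 * (d - 1) : ℕ) : ℤ) := by push_cast; rw [zpow_natCast]
      _ ≤ (2 : ℝ) ^ ((n : ℤ) - 2 * d + 2) := by
          apply zpow_le_zpow_right₀ one_le_two
          omega
  · push Not at hdn
    rw [min_eq_right hdn.le] at h
    have h1 : K * 2 ^ n ≤ 1 * 2 ^ n := by rwa [one_mul]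
    have : K ≤ 1 := Nat.le_of_mul_le_mul_right h1 (Nat.two_pow_pos n)
    omega

end Literature.InformationTheory.QuantumCodes
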